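import Summits.QuantumFields.YangMills.Theorems.FluctuationComparisonRegPrIntLS2BetaStrataOfLetters
import Summits.QuantumFields.YangMills.Theorems.FluctuationComparisonRegPrIntLS2BetaResidualGaugeOrbit
import Summits.QuantumFields.YangMills.Theorems.FluctuationComparisonRegPrIntLS2BetaResidualGaugeRooted
import HarnessLib

/-!
# S2β ∕ GAP♯∘ strata residue (H′) — THE PURE-GAUGE TEST OF THE PAIRING LETTER (F) OF ✓`…S2BetaStrataOfLetters`:
# as texted, (F) forces every residual transformation to FIX every plaquette of every argmin background

Cell `ym3-torus` (YM ladder rung R3 = continuum `SU(2)` Yang–Mills on the three-torus — a RUNG: NOT d = 4, NOT infinite volume,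
NOT a mass gap, NOT Clay).  Width seat «width 16» `ym3-torus-px16` (gen 21), FREE px helper on crux `stmt-QuantumFields-20520`
(`FluctuationComparisonRegPrIntL`), count-neutral, DEFINITION-FREE, default heartbeats.  Companion of ✓∕⧗`…S2BetaStrataOfGaugedLetters`
(the repaired door); this file is the kernel certificate of WHY the repair is needed — a tightness theorem about a HYPOTHESIS text, not a
refutation of any registered statement.

THE TEST.  In ✓`…S2BetaStrataOfLetters` the letter (F) reads, after the prefix of ✓(D10),
`∀ U₀ ∈ argmin, ∀ U ∈ fibre ∩ histGood, −LIN(U;U₀) ≤ c·x(U;U₀) + ¼·REL(U;U₀)` with `x(U;U₀) = N⁻²·⨅_{w residual} Σ_ℓ dist1(U ℓ·((w•U₀) ℓ)⁻¹)²`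
(distance to the residual ORBIT), `E_p := (U₀(∂p))⁻¹·U(∂p)`, `REL := Σ_p (1 − reTr E_p)`, `LIN := Σ_p ⟪imVec q(U₀(∂p)), imVec q(E_p)⟫`.
Take `U := w•U₀` with `w` residual.  Then `U ∈ fibre ∩ histGood` (✓`gaugeAct_mem_argmin_iff_of_residual`), `x = 0`
(✓`iInf_orbitDistSq_eq_zero_of_residual`), `A(U) = A(U₀)`, and the exact split ✓`wilsonAction4_sub_eq` gives
`LIN(w•U₀; U₀) = −Σ_p reTr(U₀(∂p))·(1 − reTr E_p)` (§1 `lin_gaugeAct_self_eq`).  With `dist1 U₀(∂p) ≤ ½` (a good history at level 0 once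
`θBal(K) ≤ ½`) every weight is `reTr U₀(∂p) ≥ 7∕8 > ¼`, so the letter's inequality `Σ_p (reTr U₀(∂p) − ¼)·(1 − reTr E_p) ≤ 0` forces
`reTr E_p = 1`, i.e. `(w•U₀)(∂p) = U₀(∂p)` for EVERY plaquette (§1 ★`plaqHol_gaugeAct_eq_of_pairing`).  Threaded through the prefix:
★★ `plaqHol_fixed_of_pairingLetter (G) (hF)` — the (F) text with an arbitrary stratum guard `G` implies that on its whole window every residual
`w` fixes every plaquette of every argmin background; with `w` a ONE-SITE BUMP `g` at a site off the block-centre tower (residual, §2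
`residual_update_of_offTower` ∘ ✓`residual_of_isResidual`) this is ★★ `conj_plaqHol_eq_of_pairingLetter`: EVERY `g ∈ SU(2)` commutes with
every plaquette of `U₀` based at such a site — the argmin would be central (`= 1`, being small) at every off-tower plaquette, which no
non-flat datum allows (both strata of GAP♯∘ are non-flat by their guards).  (The distance letter (D) is untouched: `x = 0` there.)
§4 ★★ `not_pairingLetter_of_nonflatArgminWitness`: the `¬`-shape — the letter is FALSE modulo a «non-flat argmin witness family» (the game-dual of
its prefix ending in one residual `w` and one plaquette with `(w•U₀)(∂p) ≠ U₀(∂p)`; inhabiting it = the 19200-class argmin letters, not attempted).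
CONSEQUENCE (recorded in ✓∕⧗`…S2BetaStrataOfGaugedLetters`): (F) must be stated against the PLAIN distance `Σ_ℓ dist1(U ℓ·(U₀ ℓ)⁻¹)²` —
UV3-NODE §75.2 (d)'s mechanism — and the orbit infimum recovered inside the door by moving the background along its residual orbit.

HONEST SCOPE.  Elementary bookkeeping over landed RG-K letters and the exact excess split; nothing of Bałaban's analysis is asserted or
proved; no registered statement is refuted (the letters are hypotheses of a helper door); `hIrr`, `hA`, GAP♯∘ (`stub_uniformFibreGapOrbit`),
S2β, the five registered stubs of `Lines/semiclassical_s2beta.lean` (3732b7df), crux 20520, 19936, 19200 and `YM3TorusSU2` are NOT proved;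
the Yang–Mills mass gap is NOT proved.  Sorry-free, axioms standard.

References: T. Bałaban, CMP **102** (1985) 277–309 [Balaban1985Variational] (Thm 1 (8)–(10) p.279; (4) p.278; (34) p.283);
CMP **109** (1987) 249–301 [Balaban1987RG1] (p.256, the residual sheet `u = 1` on `T⁽ᵏ⁾`); CMP **102** (1985) 255–275 [Balaban1985UV3] ((7) p.257).
-/

set_option autoImplicit false

noncomputable section

open Set Function
open scoped Matrix.Norms.L2Operator RealInnerProductSpace
open Literature.MathematicalPhysics.QuantumLattice (su2Quat)
open Literature.MathematicalPhysics.QuantumFieldTheory.Balaban1983to89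
open Literature.MathematicalPhysics.QuantumFieldTheory.Balaban1983to89.T4Continuum
open Literature.MathematicalPhysics.QuantumFieldTheory.Balaban1983to89.B15DeterminingSets (embIter)
open Literature.MathematicalPhysics.QuantumFieldTheory.Balaban1983to89.T3ContinuumYM3Torus
open Literature.MathematicalPhysics.QuantumFieldTheory.Balaban1983to89.T3UnitLawDensityEML (ℰp)
open Literature.MathematicalPhysics.QuantumFieldTheory.Balaban1983to89.T3UnitScaleTilt
open Literature.MathematicalPhysics.QuantumFieldTheory.Balaban1983to89.T3TiltDescent
open Literature.MathematicalPhysics.QuantumFieldTheory.Balaban1983to89.T3Thresholds (exists_gamma_forall_θBal_le)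
open Literature.MathematicalPhysics.QuantumFieldTheory.Balaban1983to89.T3ConstrainedMinimiser (fibre)
open Literature.MathematicalPhysics.QuantumFieldTheory.Balaban1983to89.T3PrintedRegularMinimiser
open Literature.MathematicalPhysics.QuantumFieldTheory.Balaban1983to89.T3PrintedRegularOrbits
open Literature.MathematicalPhysics.QuantumFieldTheory.Balaban1983to89.T4ExpWindowSmallField (imVec)
open Summit.QuantumFields.YangMills.Theorems.AvgActionDefect (one_sub_reTr_eq_half_dist1_sq_su2)
open Summit.QuantumFields.YangMills.Theorems.FluctuationComparisonRegPrIntLS2BetaExcessSplit (wilsonAction4_sub_eq)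
open Summit.QuantumFields.YangMills.Theorems.FluctuationComparisonRegPrIntLS2BetaStrataOfLetters (dist1_plaqHol_lt_of_mem_histGood_zero)
open Summit.QuantumFields.YangMills.Theorems.FluctuationComparisonRegPrIntLS2BetaResidualGauge (gaugeAct_mem_argmin_iff_of_residual)
open Summit.QuantumFields.YangMills.Theorems.FluctuationComparisonRegPrIntLS2BetaResidualGaugeOrbit (eq_one_of_dist1_eq_zero
  iInf_orbitDistSq_eq_zero_of_residual)
open Summit.QuantumFields.YangMills.Theorems.FluctuationComparisonRegPrIntLS2BetaResidualGaugeRooted (residual_of_isResidual)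

namespace Summit.QuantumFields.YangMills.Theorems.FluctuationComparisonRegPrIntLS2BetaPairingLetterPureGaugeTest

/-! ## §1 Pair level: the pairing at a pure-gauge field, and what the letter's inequality forces there -/

/-- **THE PAIRING AT A PURE-GAUGE FIELD**: `LIN(w•U₀; U₀) = −Σ_p reTr(U₀(∂p))·(1 − reTr E_p)` — the exact split ✓`wilsonAction4_sub_eq` at
`U := w•U₀`, whose left side `A(w•U₀) − A(U₀)` vanishes. [cite: Balaban1985Variational, (34) p.283, (1) p.278] -/
theorem lin_gaugeAct_self_eq {P : Params} {j : ℕ} (w : GaugeTransf P j (Matrix.specialUnitaryGroup (Fin 2) ℂ))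
    (U₀ : GaugeField P j (Matrix.specialUnitaryGroup (Fin 2) ℂ)) :
    ∑ p : Plaq P j, inner ℝ (imVec (su2Quat (GaugeField.plaqHol U₀ p)))
        (imVec (su2Quat ((GaugeField.plaqHol U₀ p)⁻¹ * GaugeField.plaqHol (GaugeField.gaugeAct w U₀) p))) =
      -∑ p : Plaq P j, reTr (GaugeField.plaqHol U₀ p) * (1 - reTr ((GaugeField.plaqHol U₀ p)⁻¹ * GaugeField.plaqHol (GaugeField.gaugeAct w U₀) p)) := by
  have h := wilsonAction4_sub_eq (GaugeField.gaugeAct w U₀) U₀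
  have h0 : wilsonAction4 (GaugeField.gaugeAct w U₀) = wilsonAction4 U₀ := T4WilsonGaugeFlatDirection.wilsonAction_gaugeAct 1 w U₀
  rw [h0, sub_self] at h
  linarith

/-- ★ **WHAT THE LETTER'S INEQUALITY FORCES AT A PURE-GAUGE FIELD**: if the background plaquettes satisfy `dist1 U₀(∂p) ≤ ½` and
`−LIN(w•U₀; U₀) ≤ a + ¼·REL(w•U₀; U₀)` with `a ≤ 0`, then `(w•U₀)(∂p) = U₀(∂p)` for every plaquette (`reTr U₀(∂p) = 1 − ½dist1² ≥ 7∕8`, each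
term `(reTr U₀(∂p) − ¼)·(1 − reTr E_p) ≥ 0` of a sum `≤ 0` vanishes, `reTr E = 1 ⇒ dist1 E = 0 ⇒ E = 1`). [cite: Balaban1985Variational, Thm 1 (9) p.279] -/
theorem plaqHol_gaugeAct_eq_of_pairing {P : Params} {j : ℕ} (w : GaugeTransf P j (Matrix.specialUnitaryGroup (Fin 2) ℂ))
    (U₀ : GaugeField P j (Matrix.specialUnitaryGroup (Fin 2) ℂ)) (hθ : ∀ p, dist1 (GaugeField.plaqHol U₀ p) ≤ 1 / 2) {a : ℝ} (ha : a ≤ 0)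
    (h : -(∑ p : Plaq P j, inner ℝ (imVec (su2Quat (GaugeField.plaqHol U₀ p)))
          (imVec (su2Quat ((GaugeField.plaqHol U₀ p)⁻¹ * GaugeField.plaqHol (GaugeField.gaugeAct w U₀) p))))
        ≤ a + 1 / 4 * ∑ p : Plaq P j, (1 - reTr ((GaugeField.plaqHol U₀ p)⁻¹ * GaugeField.plaqHol (GaugeField.gaugeAct w U₀) p))) :
    ∀ p : Plaq P j, GaugeField.plaqHol (GaugeField.gaugeAct w U₀) p = GaugeField.plaqHol U₀ p := by
  rw [lin_gaugeAct_self_eq, neg_neg, Finset.mul_sum] at h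
  have hterm : ∀ p : Plaq P j, 0 ≤ 1 - reTr ((GaugeField.plaqHol U₀ p)⁻¹ * GaugeField.plaqHol (GaugeField.gaugeAct w U₀) p) :=
    fun p => by linarith [GaugeGroup.reTr_le_one ((GaugeField.plaqHol U₀ p)⁻¹ * GaugeField.plaqHol (GaugeField.gaugeAct w U₀) p)]
  have hP₀ : ∀ p : Plaq P j, 7 / 8 ≤ reTr (GaugeField.plaqHol U₀ p) := fun p => by
    have h1 := one_sub_reTr_eq_half_dist1_sq_su2 (GaugeField.plaqHol U₀ p)
    have hd : dist1 (GaugeField.plaqHol U₀ p) ^ 2 ≤ (1 / 2) ^ 2 := pow_le_pow_left₀ (GaugeGroup.dist1_nonneg _) (hθ p) 2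
    nlinarith
  have hsum : ∑ p : Plaq P j, (5 / 8 : ℝ) * (1 - reTr ((GaugeField.plaqHol U₀ p)⁻¹ * GaugeField.plaqHol (GaugeField.gaugeAct w U₀) p)) ≤ 0 := by
    have h' : ∑ p : Plaq P j, (reTr (GaugeField.plaqHol U₀ p) * (1 - reTr ((GaugeField.plaqHol U₀ p)⁻¹ * GaugeField.plaqHol (GaugeField.gaugeAct w U₀) p)) -
        1 / 4 * (1 - reTr ((GaugeField.plaqHol U₀ p)⁻¹ * GaugeField.plaqHol (GaugeField.gaugeAct w U₀) p))) ≤ a := by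
      rw [Finset.sum_sub_distrib]; linarith
    refine le_trans (Finset.sum_le_sum fun p _ => ?_) (h'.trans ha)
    nlinarith [hP₀ p, hterm p]
  have hzero := (Finset.sum_eq_zero_iff_of_nonneg fun p _ => mul_nonneg (by norm_num : (0 : ℝ) ≤ 5 / 8) (hterm p)).mp
    (le_antisymm hsum (Finset.sum_nonneg fun p _ => mul_nonneg (by norm_num : (0 : ℝ) ≤ 5 / 8) (hterm p)))
  intro p
  have hz : 1 - reTr ((GaugeField.plaqHol U₀ p)⁻¹ * GaugeField.plaqHol (GaugeField.gaugeAct w U₀) p) = 0 := by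
    have := hzero p (Finset.mem_univ p); linarith
  have hd : dist1 ((GaugeField.plaqHol U₀ p)⁻¹ * GaugeField.plaqHol (GaugeField.gaugeAct w U₀) p) = 0 := by
    have h1 := one_sub_reTr_eq_half_dist1_sq_su2 ((GaugeField.plaqHol U₀ p)⁻¹ * GaugeField.plaqHol (GaugeField.gaugeAct w U₀) p)
    rw [hz] at h1
    exact (pow_eq_zero_iff two_ne_zero).mp (by linarith)
  have hE := eq_one_of_dist1_eq_zero _ hd
  exact (inv_mul_eq_one.mp hE).symm

/-! ## §2 One-site bumps off the block-centre tower are residual -/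

section Bump

variable (F : T3Family) {J K : ℕ} (hJK : J ≤ K)

/-- **A ONE-SITE BUMP OFF THE BLOCK-CENTRE TOWER IS RESIDUAL**: if `x` is not a site of the `(K−J)`-th centre lattice `T⁽ᴷ⁻ᴶ⁾ ⊂ T`, then
`w := 1` updated to `g` at `x` satisfies print's sheet condition `w = 1` on `T⁽ᴷ⁻ᴶ⁾`, hence is residual (✓`residual_of_isResidual`).
[cite: Balaban1987RG1, p.256 (three sentences after (0.21)); Balaban1985Variational, (4) p.278] -/
theorem residual_update_of_offTower {x : Site (F.P K) 0} (hx : ∀ y : Site (F.P K) (K - J), embIter (K - J) y ≠ x)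
    (g : Matrix.specialUnitaryGroup (Fin 2) ℂ) :
    ∀ U : GaugeField (F.P K) 0 (Matrix.specialUnitaryGroup (Fin 2) ℂ),
      descendTo F ℰp J K hJK (GaugeField.gaugeAct (Function.update (1 : Site (F.P K) 0 → Matrix.specialUnitaryGroup (Fin 2) ℂ) x g) U) =
        descendTo F ℰp J K hJK U :=
  residual_of_isResidual F hJK fun y => by
    rw [Function.update_of_ne (hx y)]
    rfl

/-- The plaquette of a one-site bump at the plaquette's base corner is the conjugate plaquette. [cite: Balaban1985Averaging, (8)-(9) p.19] -/
theorem plaqHol_gaugeAct_update {x : Site (F.P K) 0} (g : Matrix.specialUnitaryGroup (Fin 2) ℂ)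
    (U₀ : GaugeField (F.P K) 0 (Matrix.specialUnitaryGroup (Fin 2) ℂ)) (p : Plaq (F.P K) 0) (hp : p.src = x) :
    GaugeField.plaqHol (GaugeField.gaugeAct (Function.update (1 : Site (F.P K) 0 → Matrix.specialUnitaryGroup (Fin 2) ℂ) x g) U₀) p =
      g * GaugeField.plaqHol U₀ p * g⁻¹ := by
  rw [T4WilsonGaugeFlatDirection.plaqHol_gaugeAct, hp, Function.update_self]

end Bump

/-! ## §3 Threaded through the prefix: the (F) text of ✓`…S2BetaStrataOfLetters` with an arbitrary stratum guard -/

/-- ★★ **THE PAIRING LETTER (F), AS TEXTED, FORCES EVERY RESIDUAL TRANSFORMATION TO FIX EVERY PLAQUETTE OF EVERY ARGMIN BACKGROUND.**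
Hypothesis = the (F) input of ✓`…S2BetaStrataOfLetters.gapStratum_of_letters` VERBATIM (guard `G F J V` arbitrary); conclusion: on the same
window, `∀ U₀ ∈ argmin, ∀ w residual, ∀ p, (w•U₀)(∂p) = U₀(∂p)`.  PROOF: `c := 1`; `γ` small enough for `θBal(K) ≤ ½`; test at `U := w•U₀`
(`x = 0`), then §1. [cite: Balaban1985Variational, Thm 1 (8)-(10) p.279, (4) p.278, (34) p.283; Balaban1985UV3, (7) p.257] -/
theorem plaqHol_fixed_of_pairingLetter
    (G : (F : T3Family) → (J : ℕ) → GaugeField (F.P J) 0 (Matrix.specialUnitaryGroup (Fin 2) ℂ) → Prop)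
    (hF : ∀ (L : ℕ), ∃ c₀ : ℝ, 0 < c₀ ∧ c₀ ≤ 1 ∧ ∀ (cw : ℝ), 0 < cw → cw ≤ c₀ → ∃ pS : ℝ, ∀ (b₀ p₀ : ℝ), 0 < b₀ → pS ≤ p₀ → 0 < p₀ → ∃ ε₁ : ℝ, 0 < ε₁ ∧ ∀ (ε₀ : ℝ), 0 < ε₀ → ε₀ ≤ ε₁ →
    ∀ (c : ℝ), 0 < c → ∃ γ₁ : ℝ, 0 < γ₁ ∧ ∀ (F : T3Family) (γ : ℝ), F.L = L → 0 < γ → γ ≤ γ₁ →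
      ∀ (J K : ℕ) (hJK : J ≤ K) (V : GaugeField (F.P J) 0 (Matrix.specialUnitaryGroup (Fin 2) ℂ)), PlaqSmall (θBal F.L γ (cw * b₀) p₀ J) V →
        G F J V →
        ∀ U₀ ∈ {U' : GaugeField (F.P K) 0 (Matrix.specialUnitaryGroup (Fin 2) ℂ) | U' ∈ fibre F ℰp J K hJK V ∧ U' ∈ histGood F ℰp (θBal F.L γ b₀ p₀) K J ∧
            wilsonAction4 U' = minActionRegPr F J K hJK ε₀ V},
        ∀ U ∈ fibre F ℰp J K hJK V, U ∈ histGood F ℰp (θBal F.L γ b₀ p₀) K J →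
          -(∑ p : Plaq (F.P K) 0,
              inner ℝ (imVec (su2Quat (GaugeField.plaqHol U₀ p))) (imVec (su2Quat ((GaugeField.plaqHol U₀ p)⁻¹ * GaugeField.plaqHol U p))))
            ≤ c * (((F.L : ℝ)⁻¹) ^ (2 * (K - J)) *
              (⨅ w : {w : GaugeTransf (F.P K) 0 (Matrix.specialUnitaryGroup (Fin 2) ℂ) | ∀ U : GaugeField (F.P K) 0 (Matrix.specialUnitaryGroup (Fin 2) ℂ),
                  descendTo F ℰp J K hJK (GaugeField.gaugeAct w U) = descendTo F ℰp J K hJK U}, ∑ ℓ : PBond (F.P K) 0,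
                dist1 (U ℓ * ((GaugeField.gaugeAct (w : GaugeTransf (F.P K) 0 (Matrix.specialUnitaryGroup (Fin 2) ℂ)) U₀) ℓ)⁻¹) ^ 2)) +
              1 / 4 * ∑ p : Plaq (F.P K) 0, (1 - reTr ((GaugeField.plaqHol U₀ p)⁻¹ * GaugeField.plaqHol U p))) :
    ∀ (L : ℕ), ∃ c₀ : ℝ, 0 < c₀ ∧ c₀ ≤ 1 ∧ ∀ (cw : ℝ), 0 < cw → cw ≤ c₀ → ∃ pS : ℝ, ∀ (b₀ p₀ : ℝ), 0 < b₀ → pS ≤ p₀ → 0 < p₀ → ∃ ε₁ : ℝ, 0 < ε₁ ∧ ∀ (ε₀ : ℝ), 0 < ε₀ → ε₀ ≤ ε₁ →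
    ∃ γ₁ : ℝ, 0 < γ₁ ∧ ∀ (F : T3Family) (γ : ℝ), F.L = L → 0 < γ → γ ≤ γ₁ →
      ∀ (J K : ℕ) (hJK : J ≤ K) (V : GaugeField (F.P J) 0 (Matrix.specialUnitaryGroup (Fin 2) ℂ)), PlaqSmall (θBal F.L γ (cw * b₀) p₀ J) V →
        G F J V →
        ∀ U₀ ∈ {U' : GaugeField (F.P K) 0 (Matrix.specialUnitaryGroup (Fin 2) ℂ) | U' ∈ fibre F ℰp J K hJK V ∧ U' ∈ histGood F ℰp (θBal F.L γ b₀ p₀) K J ∧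
            wilsonAction4 U' = minActionRegPr F J K hJK ε₀ V},
        ∀ w : GaugeTransf (F.P K) 0 (Matrix.specialUnitaryGroup (Fin 2) ℂ),
          (∀ U' : GaugeField (F.P K) 0 (Matrix.specialUnitaryGroup (Fin 2) ℂ),
            descendTo F ℰp J K hJK (GaugeField.gaugeAct w U') = descendTo F ℰp J K hJK U') →
          ∀ p : Plaq (F.P K) 0, GaugeField.plaqHol (GaugeField.gaugeAct w U₀) p = GaugeField.plaqHol U₀ p := by
  intro L
  obtain ⟨c₀, hc₀, hc₀1, H⟩ := hF L
  refine ⟨c₀, hc₀, hc₀1, ?_⟩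
  intro cw hcw hcwle
  obtain ⟨pS, H⟩ := H cw hcw hcwle
  refine ⟨pS, ?_⟩
  intro b₀ p₀ hb hpS hp
  obtain ⟨ε₁, hε₁, H⟩ := H b₀ p₀ hb hpS hp
  refine ⟨ε₁, hε₁, ?_⟩
  intro ε₀ hε₀ hε₀le
  obtain ⟨γF, hγF, H⟩ := H ε₀ hε₀ hε₀le 1 one_pos
  obtain ⟨γc, hγc, -, hθ⟩ := exists_gamma_forall_θBal_le (b₀ := b₀) (p₀ := p₀) hb hp (σ := 1 / 2) (by norm_num)
  refine ⟨min γF γc, lt_min hγF hγc, ?_⟩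
  intro F γ hFL hγ hγle J K hJK V hV hG U₀ hU₀ w hw
  -- the pure-gauge test field `w•U₀` is admissible
  have hU : GaugeField.gaugeAct w U₀ ∈ {U' : GaugeField (F.P K) 0 (Matrix.specialUnitaryGroup (Fin 2) ℂ) | U' ∈ fibre F ℰp J K hJK V ∧
      U' ∈ histGood F ℰp (θBal F.L γ b₀ p₀) K J ∧ wilsonAction4 U' = minActionRegPr F J K hJK ε₀ V} :=
    (gaugeAct_mem_argmin_iff_of_residual F hJK hw U₀ V).mpr hU₀
  have hFx := H F γ hFL hγ (hγle.trans (min_le_left _ _)) J K hJK V hV hG U₀ hU₀ (GaugeField.gaugeAct w U₀) hU.1 hU.2.1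
  -- its orbit distance vanishes
  have hx0 : (⨅ w' : {w : GaugeTransf (F.P K) 0 (Matrix.specialUnitaryGroup (Fin 2) ℂ) | ∀ U : GaugeField (F.P K) 0 (Matrix.specialUnitaryGroup (Fin 2) ℂ),
                  descendTo F ℰp J K hJK (GaugeField.gaugeAct w U) = descendTo F ℰp J K hJK U}, ∑ ℓ : PBond (F.P K) 0,
                dist1 ((GaugeField.gaugeAct w U₀) ℓ * ((GaugeField.gaugeAct (w' : GaugeTransf (F.P K) 0 (Matrix.specialUnitaryGroup (Fin 2) ℂ)) U₀) ℓ)⁻¹) ^ 2) = 0 :=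
    iInf_orbitDistSq_eq_zero_of_residual F hJK hw U₀
  rw [hx0, mul_zero, mul_zero] at hFx
  -- the background's finest plaquettes are `≤ ½`
  have hθU₀ : ∀ p, dist1 (GaugeField.plaqHol U₀ p) ≤ 1 / 2 := fun p =>
    (dist1_plaqHol_lt_of_mem_histGood_zero F hJK (θBal F.L γ b₀ p₀) hU₀.2.1 p).le.trans
      (hθ F.L F.hL.2.le γ hγ (hγle.trans (min_le_right _ _)) K)
  exact plaqHol_gaugeAct_eq_of_pairing w U₀ hθU₀ le_rfl hFx

/-- ★★ **… HENCE EVERY `g ∈ SU(2)` COMMUTES WITH EVERY ARGMIN PLAQUETTE BASED OFF THE BLOCK-CENTRE TOWER** (the previous theorem at the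
one-site bump `w := 1[x ↦ g]`, residual by §2): the (F) text forces `g·U₀(∂p)·g⁻¹ = U₀(∂p)` for all `g`, all `U₀ ∈ argmin` and all `p` with
`p.src` off `T⁽ᴷ⁻ᴶ⁾` — i.e. such plaquettes are central (and, being small, trivial): incompatible with a non-flat datum.
[cite: Balaban1985Variational, Thm 1 (8)-(10) p.279, (4) p.278; Balaban1987RG1, p.256] -/
theorem conj_plaqHol_eq_of_pairingLetter
    (G : (F : T3Family) → (J : ℕ) → GaugeField (F.P J) 0 (Matrix.specialUnitaryGroup (Fin 2) ℂ) → Prop)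
    (hF : ∀ (L : ℕ), ∃ c₀ : ℝ, 0 < c₀ ∧ c₀ ≤ 1 ∧ ∀ (cw : ℝ), 0 < cw → cw ≤ c₀ → ∃ pS : ℝ, ∀ (b₀ p₀ : ℝ), 0 < b₀ → pS ≤ p₀ → 0 < p₀ → ∃ ε₁ : ℝ, 0 < ε₁ ∧ ∀ (ε₀ : ℝ), 0 < ε₀ → ε₀ ≤ ε₁ →
    ∀ (c : ℝ), 0 < c → ∃ γ₁ : ℝ, 0 < γ₁ ∧ ∀ (F : T3Family) (γ : ℝ), F.L = L → 0 < γ → γ ≤ γ₁ →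
      ∀ (J K : ℕ) (hJK : J ≤ K) (V : GaugeField (F.P J) 0 (Matrix.specialUnitaryGroup (Fin 2) ℂ)), PlaqSmall (θBal F.L γ (cw * b₀) p₀ J) V →
        G F J V →
        ∀ U₀ ∈ {U' : GaugeField (F.P K) 0 (Matrix.specialUnitaryGroup (Fin 2) ℂ) | U' ∈ fibre F ℰp J K hJK V ∧ U' ∈ histGood F ℰp (θBal F.L γ b₀ p₀) K J ∧
            wilsonAction4 U' = minActionRegPr F J K hJK ε₀ V},
        ∀ U ∈ fibre F ℰp J K hJK V, U ∈ histGood F ℰp (θBal F.L γ b₀ p₀) K J →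
          -(∑ p : Plaq (F.P K) 0,
              inner ℝ (imVec (su2Quat (GaugeField.plaqHol U₀ p))) (imVec (su2Quat ((GaugeField.plaqHol U₀ p)⁻¹ * GaugeField.plaqHol U p))))
            ≤ c * (((F.L : ℝ)⁻¹) ^ (2 * (K - J)) *
              (⨅ w : {w : GaugeTransf (F.P K) 0 (Matrix.specialUnitaryGroup (Fin 2) ℂ) | ∀ U : GaugeField (F.P K) 0 (Matrix.specialUnitaryGroup (Fin 2) ℂ),
                  descendTo F ℰp J K hJK (GaugeField.gaugeAct w U) = descendTo F ℰp J K hJK U}, ∑ ℓ : PBond (F.P K) 0,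
                dist1 (U ℓ * ((GaugeField.gaugeAct (w : GaugeTransf (F.P K) 0 (Matrix.specialUnitaryGroup (Fin 2) ℂ)) U₀) ℓ)⁻¹) ^ 2)) +
              1 / 4 * ∑ p : Plaq (F.P K) 0, (1 - reTr ((GaugeField.plaqHol U₀ p)⁻¹ * GaugeField.plaqHol U p))) :
    ∀ (L : ℕ), ∃ c₀ : ℝ, 0 < c₀ ∧ c₀ ≤ 1 ∧ ∀ (cw : ℝ), 0 < cw → cw ≤ c₀ → ∃ pS : ℝ, ∀ (b₀ p₀ : ℝ), 0 < b₀ → pS ≤ p₀ → 0 < p₀ → ∃ ε₁ : ℝ, 0 < ε₁ ∧ ∀ (ε₀ : ℝ), 0 < ε₀ → ε₀ ≤ ε₁ →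
    ∃ γ₁ : ℝ, 0 < γ₁ ∧ ∀ (F : T3Family) (γ : ℝ), F.L = L → 0 < γ → γ ≤ γ₁ →
      ∀ (J K : ℕ) (hJK : J ≤ K) (V : GaugeField (F.P J) 0 (Matrix.specialUnitaryGroup (Fin 2) ℂ)), PlaqSmall (θBal F.L γ (cw * b₀) p₀ J) V →
        G F J V →
        ∀ U₀ ∈ {U' : GaugeField (F.P K) 0 (Matrix.specialUnitaryGroup (Fin 2) ℂ) | U' ∈ fibre F ℰp J K hJK V ∧ U' ∈ histGood F ℰp (θBal F.L γ b₀ p₀) K J ∧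
            wilsonAction4 U' = minActionRegPr F J K hJK ε₀ V},
        ∀ x : Site (F.P K) 0, (∀ y : Site (F.P K) (K - J), embIter (K - J) y ≠ x) →
          ∀ (g : Matrix.specialUnitaryGroup (Fin 2) ℂ) (p : Plaq (F.P K) 0), p.src = x →
            g * GaugeField.plaqHol U₀ p * g⁻¹ = GaugeField.plaqHol U₀ p := by
  intro L
  obtain ⟨c₀, hc₀, hc₀1, H⟩ := plaqHol_fixed_of_pairingLetter G hF L
  refine ⟨c₀, hc₀, hc₀1, ?_⟩
  intro cw hcw hcwle
  obtain ⟨pS, H⟩ := H cw hcw hcwle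
  refine ⟨pS, ?_⟩
  intro b₀ p₀ hb hpS hp
  obtain ⟨ε₁, hε₁, H⟩ := H b₀ p₀ hb hpS hp
  refine ⟨ε₁, hε₁, ?_⟩
  intro ε₀ hε₀ hε₀le
  obtain ⟨γ₁, hγ₁, H⟩ := H ε₀ hε₀ hε₀le
  refine ⟨γ₁, hγ₁, ?_⟩
  intro F γ hFL hγ hγle J K hJK V hV hG U₀ hU₀ x hx g p hp
  have h := H F γ hFL hγ hγle J K hJK V hV hG U₀ hU₀ _ (residual_update_of_offTower F hJK hx g) p
  rwa [plaqHol_gaugeAct_update F g U₀ p hp] at h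

/-! ## §4 The `¬` shape: the letter is refuted by any NON-FLAT ARGMIN WITNESS FAMILY -/

/-- ★★ **`¬ (F)` MODULO A NON-FLAT ARGMIN WITNESS FAMILY.**  Hypothesis `hW` = the game-dual of the letter's prefix ending in ONE violation:
along `γ → 0` (for every `γ₁`) the window holds an admissible instance — a datum `V` (small plaquettes, guard `G`), an argmin background `U₀`
over it, a residual `w` and a plaquette with `(w•U₀)(∂p) ≠ U₀(∂p)` (any argmin with ONE non-central plaquette based off the block-centre tower
supplies it, by a one-site bump there, §2).  Conclusion: the (F) text of ✓`…S2BetaStrataOfLetters` (guard `G`) is FALSE.  Inhabiting `hW` in the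
tree = existence AND regularity of constrained minimisers over non-flat data at every small `γ` (the 19200-class argmin letters) — not attempted
here; this theorem is the honest `¬`-shape «infeasible modulo a non-flat argmin». [cite: Balaban1985Variational, Thm 1 (8)-(10) p.279, (4) p.278] -/
theorem not_pairingLetter_of_nonflatArgminWitness
    (G : (F : T3Family) → (J : ℕ) → GaugeField (F.P J) 0 (Matrix.specialUnitaryGroup (Fin 2) ℂ) → Prop)
    (hW : ∃ L : ℕ, ∀ c₀ : ℝ, 0 < c₀ → c₀ ≤ 1 → ∃ cw : ℝ, 0 < cw ∧ cw ≤ c₀ ∧ ∀ pS : ℝ, ∃ b₀ p₀ : ℝ, 0 < b₀ ∧ pS ≤ p₀ ∧ 0 < p₀ ∧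
      ∀ ε₁ : ℝ, 0 < ε₁ → ∃ ε₀ : ℝ, 0 < ε₀ ∧ ε₀ ≤ ε₁ ∧ ∀ γ₁ : ℝ, 0 < γ₁ →
        ∃ (F : T3Family) (γ : ℝ), F.L = L ∧ 0 < γ ∧ γ ≤ γ₁ ∧
          ∃ (J K : ℕ) (hJK : J ≤ K) (V : GaugeField (F.P J) 0 (Matrix.specialUnitaryGroup (Fin 2) ℂ)),
            PlaqSmall (θBal F.L γ (cw * b₀) p₀ J) V ∧ G F J V ∧
            ∃ U₀ ∈ {U' : GaugeField (F.P K) 0 (Matrix.specialUnitaryGroup (Fin 2) ℂ) | U' ∈ fibre F ℰp J K hJK V ∧ U' ∈ histGood F ℰp (θBal F.L γ b₀ p₀) K J ∧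
                wilsonAction4 U' = minActionRegPr F J K hJK ε₀ V},
              ∃ w : GaugeTransf (F.P K) 0 (Matrix.specialUnitaryGroup (Fin 2) ℂ),
                (∀ U' : GaugeField (F.P K) 0 (Matrix.specialUnitaryGroup (Fin 2) ℂ),
                  descendTo F ℰp J K hJK (GaugeField.gaugeAct w U') = descendTo F ℰp J K hJK U') ∧
                ∃ p : Plaq (F.P K) 0, GaugeField.plaqHol (GaugeField.gaugeAct w U₀) p ≠ GaugeField.plaqHol U₀ p) :
    ¬ (∀ (L : ℕ), ∃ c₀ : ℝ, 0 < c₀ ∧ c₀ ≤ 1 ∧ ∀ (cw : ℝ), 0 < cw → cw ≤ c₀ → ∃ pS : ℝ, ∀ (b₀ p₀ : ℝ), 0 < b₀ → pS ≤ p₀ → 0 < p₀ → ∃ ε₁ : ℝ, 0 < ε₁ ∧ ∀ (ε₀ : ℝ), 0 < ε₀ → ε₀ ≤ ε₁ →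
    ∀ (c : ℝ), 0 < c → ∃ γ₁ : ℝ, 0 < γ₁ ∧ ∀ (F : T3Family) (γ : ℝ), F.L = L → 0 < γ → γ ≤ γ₁ →
      ∀ (J K : ℕ) (hJK : J ≤ K) (V : GaugeField (F.P J) 0 (Matrix.specialUnitaryGroup (Fin 2) ℂ)), PlaqSmall (θBal F.L γ (cw * b₀) p₀ J) V →
        G F J V →
        ∀ U₀ ∈ {U' : GaugeField (F.P K) 0 (Matrix.specialUnitaryGroup (Fin 2) ℂ) | U' ∈ fibre F ℰp J K hJK V ∧ U' ∈ histGood F ℰp (θBal F.L γ b₀ p₀) K J ∧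
            wilsonAction4 U' = minActionRegPr F J K hJK ε₀ V},
        ∀ U ∈ fibre F ℰp J K hJK V, U ∈ histGood F ℰp (θBal F.L γ b₀ p₀) K J →
          -(∑ p : Plaq (F.P K) 0,
              inner ℝ (imVec (su2Quat (GaugeField.plaqHol U₀ p))) (imVec (su2Quat ((GaugeField.plaqHol U₀ p)⁻¹ * GaugeField.plaqHol U p))))
            ≤ c * (((F.L : ℝ)⁻¹) ^ (2 * (K - J)) *
              (⨅ w : {w : GaugeTransf (F.P K) 0 (Matrix.specialUnitaryGroup (Fin 2) ℂ) | ∀ U : GaugeField (F.P K) 0 (Matrix.specialUnitaryGroup (Fin 2) ℂ),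
                  descendTo F ℰp J K hJK (GaugeField.gaugeAct w U) = descendTo F ℰp J K hJK U}, ∑ ℓ : PBond (F.P K) 0,
                dist1 (U ℓ * ((GaugeField.gaugeAct (w : GaugeTransf (F.P K) 0 (Matrix.specialUnitaryGroup (Fin 2) ℂ)) U₀) ℓ)⁻¹) ^ 2)) +
              1 / 4 * ∑ p : Plaq (F.P K) 0, (1 - reTr ((GaugeField.plaqHol U₀ p)⁻¹ * GaugeField.plaqHol U p))) := by
  intro hF
  obtain ⟨L, hL⟩ := hW
  obtain ⟨c₀, hc₀, hc₀1, H⟩ := plaqHol_fixed_of_pairingLetter G hF L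
  obtain ⟨cw, hcw, hcwle, hL⟩ := hL c₀ hc₀ hc₀1
  obtain ⟨pS, H⟩ := H cw hcw hcwle
  obtain ⟨b₀, p₀, hb, hpS, hp, hL⟩ := hL pS
  obtain ⟨ε₁, hε₁, H⟩ := H b₀ p₀ hb hpS hp
  obtain ⟨ε₀, hε₀, hε₀le, hL⟩ := hL ε₁ hε₁
  obtain ⟨γ₁, hγ₁, H⟩ := H ε₀ hε₀ hε₀le
  obtain ⟨F, γ, hFL, hγ, hγle, J, K, hJK, V, hV, hG, U₀, hU₀, w, hw, p, hp'⟩ := hL γ₁ hγ₁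
  exact hp' (H F γ hFL hγ hγle J K hJK V hV hG U₀ hU₀ w hw p)

end Summit.QuantumFields.YangMills.Theorems.FluctuationComparisonRegPrIntLS2BetaPairingLetterPureGaugeTest

end
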